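import Summits.CriticalPhenomena.PercolationContinuityZ3.Theorems.Transplant.FKConnectivityAllQAntipodalDefs
import Summits.CriticalPhenomena.PercolationContinuityZ3.Theorems.Transplant.FKConnectivityAllQSPGluing
import HarnessLib

/-!
# Connectivity correlation inequalities for `φ_{w,q}`, every `q > 0` — file 21a: series / parallel COMPOSITION LAWS of the
# antipodal up-correlation functional

Support file (`--supports stmt-CriticalPhenomena-4575`), FK sub-lane `prim-bschramm-fk-2` (gen 11) of the post-continuity
programme; builds on p205010 (kernel theorem, internal audit signed; external expert review pending).  No definitions, no named
facts, no sorries; standard axioms.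

For an edge set `M`, terminals `s, t`, `q ∈ ℝ` and a test function `h`, `FK.apUpc q M s t h = ∑_{γ ⊆ M} q^{k(γ)+k(M\γ)} (c(γ) - c(M\γ)) h(γ)`
(`…AntipodalDefs.lean`; `c = 1{s ↔ t}`, `k = clusterCount · ∅`).  This file proves the two composition laws that drive the induction of
`…AntipodalUpc.lean`.  Let `E₁, E₂` be edge-disjoint with spanned vertex sets `V₁, V₂`, `M_i ⊆ E_i`, `γ_i ⊆ M_i`, complements inside `M_i`.
* PARALLEL (`V₁ ∩ V₂ ⊆ {s,t}`, `s ≠ t`): `FK.apExp_parallel` — `k(γ)+k(γᶜ)+2|V| = Σ_i (k(γ_i)+k(γ_iᶜ)) + 1{c₁ ∧ c₂} + 1{c̄₁ ∧ c̄₂}`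
  (`FK.clusterCount_parallel` for `γ = γ₁ ⊔ γ₂` and for `γᶜ = γ₁ᶜ ⊔ γ₂ᶜ`); the type of `γ` is `(c₁ ∨ c₂, c̄₁ ∨ c̄₂)`; the pointwise identity
  `q^{c₁c₂+c̄₁c̄₂}((c₁∨c₂) - (c̄₁∨c̄₂)) = α·(c₁ - c̄₁) + β·(c₂ - c̄₂)` with `α = (1-c₂)(1-c̄₂) + q(1-c₂)c̄₂ ≥ 0`, `β = (1-c₁)(1-c̄₁) + q c₁(1-c̄₁) ≥ 0`
  (`FK.ap_summand_parallel`, sixteen cases) sums to **`FK.apUpc_parallel_eq`**: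
  `q^{2|V|}·apUpc(M₁ ⊔ M₂; s,t; h) = ∑_{γ₂} q^{a₂} α(γ₂)·apUpc(M₁; s,t; h(· ∪ γ₂)) + ∑_{γ₁} q^{a₁} β(γ₁)·apUpc(M₂; s,t; h(γ₁ ∪ ·))`, whence
  **`FK.apUpc_parallel_nonneg`**: nonnegativity on monotone test functions passes from the parts to the composite (`q > 0`).
* SERIES (`V₁ ∩ V₂ ⊆ {m}`, `a ∉ V₂`, `b ∉ V₁`): `FK.apExp_series` (no indicator terms), type `(c₁c₂, c̄₁c̄₂)` for the terminals `a, b`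
  (`c₁ = 1{a↔m}`, `c₂ = 1{m↔b}`), pointwise `c₁c₂ - c̄₁c̄₂ = c̄₂(c₁ - c̄₁) + c₁(c₂ - c̄₂)` (`FK.ap_summand_series`), **`FK.apUpc_series_eq`**,
  **`FK.apUpc_series_nonneg`**.
The sections `h(· ∪ γ₂)` of a function monotone on the subsets of `M₁ ⊔ M₂` are monotone on the subsets of `M₁`, which is all the
induction needs.  (Compare the value-level laws `…AllQSPLaw.lean` / sections `…AllQSPSections.lean` of gens 7–8: here there are no edge
weights at all — the antipodal law is parameter-free.)
[cite: Grimmett2006, §1.4 eq. (1.20) (p. 15); §3.8 Thm. (3.90) (pp. 61–62)] [cite: Wagner2006, Thm. 5.8(d), §5.3]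
-/

noncomputable section

namespace Summit.CriticalPhenomena.PercolationContinuityZ3.Theorems

namespace FK

open SimpleGraph Literature.Probability.LatticeModels Literature.Probability.Percolation
open scoped Classical

variable {V : Type*} [Fintype V]

/-! ### Bookkeeping -/

omit [Fintype V] in
/-- Summing over the subsets of a disjoint union is summing over pairs of subsets. [folklore] -/
theorem sum_powerset_union_disj {β : Type*} [AddCommMonoid β] {A B : Finset (Sym2 V)}
    (hAB : Disjoint A B) (φ : Finset (Sym2 V) → β) :
    ∑ U ∈ (A ∪ B).powerset, φ U = ∑ X ∈ A.powerset, ∑ Y ∈ B.powerset, φ (X ∪ Y) := by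
  rw [← Finset.sum_product']
  symm
  refine Finset.sum_nbij' (fun p => p.1 ∪ p.2) (fun U => (U ∩ A, U ∩ B)) ?_ ?_ ?_ ?_ (fun _ _ => rfl)
  · rintro ⟨X, Y⟩ hp
    simp only [Finset.mem_product, Finset.mem_powerset] at hp ⊢
    exact Finset.union_subset_union hp.1 hp.2
  · intro U hU
    simp only [Finset.mem_powerset] at hU
    simp only [Finset.mem_product, Finset.mem_powerset]
    exact ⟨Finset.inter_subset_right, Finset.inter_subset_right⟩
  · rintro ⟨X, Y⟩ hp
    simp only [Finset.mem_product, Finset.mem_powerset] at hp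
    simp only [Prod.mk.injEq]
    constructor
    · ext x
      simp only [Finset.mem_inter, Finset.mem_union]
      constructor
      · rintro ⟨hx | hx, hxA⟩
        · exact hx
        · exact absurd hxA (Finset.disjoint_right.1 hAB (hp.2 hx))
      · exact fun hx => ⟨Or.inl hx, hp.1 hx⟩
    · ext x
      simp only [Finset.mem_inter, Finset.mem_union]
      constructor
      · rintro ⟨hx | hx, hxB⟩
        · exact absurd hxB (Finset.disjoint_left.1 hAB (hp.1 hx))
        · exact hx
      · exact fun hx => ⟨Or.inr hx, hp.2 hx⟩
  · intro U hU
    simp only [Finset.mem_powerset] at hU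
    show U ∩ A ∪ U ∩ B = U
    rw [← Finset.inter_union_distrib_left, Finset.inter_eq_left.2 hU]

omit [Fintype V] in
/-- The connection indicator of a configuration joining the terminals is `1`. [folklore] -/
theorem apConn_of_reachable {γ : Finset (Sym2 V)} {s t : V} (h : (openGraph (↑γ : BondConfig V)).Reachable s t) :
    apConn γ s t = 1 := if_pos h

omit [Fintype V] in
/-- The connection indicator of a configuration not joining the terminals is `0`. [folklore] -/
theorem apConn_of_not_reachable {γ : Finset (Sym2 V)} {s t : V} (h : ¬ (openGraph (↑γ : BondConfig V)).Reachable s t) :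
    apConn γ s t = 0 := if_neg h

omit [Fintype V] in
/-- The connection indicator is nonnegative. [folklore] -/
theorem apConn_nonneg (γ : Finset (Sym2 V)) (s t : V) : 0 ≤ apConn γ s t := by
  unfold apConn; split_ifs <;> norm_num

omit [Fintype V] in
/-- The connection indicator is at most `1`. [folklore] -/
theorem apConn_le_one (γ : Finset (Sym2 V)) (s t : V) : apConn γ s t ≤ 1 := by
  unfold apConn; split_ifs <;> norm_num

omit [Fintype V] in
/-- Complements inside a disjoint union split. [folklore] -/
theorem union_sdiff_union {M₁ M₂ γ₁ γ₂ : Finset (Sym2 V)} (hd : Disjoint M₁ M₂) (h₁ : γ₁ ⊆ M₁) (h₂ : γ₂ ⊆ M₂) :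
    (M₁ ∪ M₂) \ (γ₁ ∪ γ₂) = (M₁ \ γ₁) ∪ (M₂ \ γ₂) := by
  ext e
  simp only [Finset.mem_sdiff, Finset.mem_union, not_or]
  constructor
  · rintro ⟨h | h, hn₁, hn₂⟩
    · exact Or.inl ⟨h, hn₁⟩
    · exact Or.inr ⟨h, hn₂⟩
  · rintro (⟨h, hn⟩ | ⟨h, hn⟩)
    · exact ⟨Or.inl h, hn, fun he => Finset.disjoint_left.1 hd h (h₂ he)⟩
    · exact ⟨Or.inr h, fun he => Finset.disjoint_right.1 hd h (h₁ he), hn⟩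

/-! ### Parallel composition -/

section Parallel

variable {E₁ E₂ : Finset (Sym2 V)} {V₁ V₂ : Set V} {s t : V}

/-- **Parallel gluing, antipodal exponent**: `k(γ) + k(γᶜ) + 2|V| = (k(γ₁) + k(γ₁ᶜ)) + (k(γ₂) + k(γ₂ᶜ)) + 1{s↔t in γ₁ and γ₂}
+ 1{s↔t in γ₁ᶜ and γ₂ᶜ}` for `γ = γ₁ ⊔ γ₂` inside `M = M₁ ⊔ M₂`, complements inside the parts. [cite: Grimmett2006, §3.8 (pp. 61–62)] -/
theorem apExp_parallel (hd : Disjoint E₁ E₂) (h₁ : ∀ e ∈ (↑E₁ : Set (Sym2 V)), ∀ z ∈ e, z ∈ V₁)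
    (h₂ : ∀ e ∈ (↑E₂ : Set (Sym2 V)), ∀ z ∈ e, z ∈ V₂) (hS : V₁ ∩ V₂ ⊆ {s, t}) (hst : s ≠ t)
    {M₁ M₂ γ₁ γ₂ : Finset (Sym2 V)} (hM₁ : M₁ ⊆ E₁) (hM₂ : M₂ ⊆ E₂) (hγ₁ : γ₁ ⊆ M₁) (hγ₂ : γ₂ ⊆ M₂) :
    apExp (M₁ ∪ M₂) (γ₁ ∪ γ₂) + 2 * Fintype.card V =
      apExp M₁ γ₁ + apExp M₂ γ₂ +
        ((if (openGraph (↑γ₁ : BondConfig V)).Reachable s t ∧ (openGraph (↑γ₂ : BondConfig V)).Reachable s t then 1 else 0) +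
          (if (openGraph (↑(M₁ \ γ₁) : BondConfig V)).Reachable s t ∧ (openGraph (↑(M₂ \ γ₂) : BondConfig V)).Reachable s t
            then 1 else 0)) := by
  have hdM : Disjoint M₁ M₂ := Finset.disjoint_of_subset_left hM₁ (Finset.disjoint_of_subset_right hM₂ hd)
  have k1 := clusterCount_parallel (ω₁ := (↑γ₁ : Set (Sym2 V))) (ω₂ := (↑γ₂ : Set (Sym2 V))) h₁ h₂ hS
    (Finset.coe_subset.2 (hγ₁.trans hM₁)) (Finset.coe_subset.2 (hγ₂.trans hM₂)) hst
  have k2 := clusterCount_parallel (ω₁ := (↑(M₁ \ γ₁) : Set (Sym2 V))) (ω₂ := (↑(M₂ \ γ₂) : Set (Sym2 V))) h₁ h₂ hS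
    (Finset.coe_subset.2 (Finset.sdiff_subset.trans hM₁)) (Finset.coe_subset.2 (Finset.sdiff_subset.trans hM₂)) hst
  unfold apExp
  rw [union_sdiff_union hdM hγ₁ hγ₂, Finset.coe_union, Finset.coe_union]
  omega

omit [Fintype V] in
/-- **Parallel gluing, terminal connection**: `s ↔ t` in `γ₁ ⊔ γ₂` iff in `γ₁` or in `γ₂`. [folklore] -/
theorem reachable_union_parallel (h₁ : ∀ e ∈ (↑E₁ : Set (Sym2 V)), ∀ z ∈ e, z ∈ V₁)
    (h₂ : ∀ e ∈ (↑E₂ : Set (Sym2 V)), ∀ z ∈ e, z ∈ V₂) (hS : V₁ ∩ V₂ ⊆ {s, t})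
    {γ₁ γ₂ : Finset (Sym2 V)} (hγ₁ : γ₁ ⊆ E₁) (hγ₂ : γ₂ ⊆ E₂) :
    (openGraph (↑(γ₁ ∪ γ₂) : BondConfig V)).Reachable s t ↔
      (openGraph (↑γ₁ : BondConfig V)).Reachable s t ∨ (openGraph (↑γ₂ : BondConfig V)).Reachable s t := by
  rw [Finset.coe_union]
  exact reachable_parallel_iff h₁ h₂ hS (Finset.coe_subset.2 hγ₁) (Finset.coe_subset.2 hγ₂)

set_option linter.unusedSimpArgs false in
/-- **Parallel gluing, the antipodal summand**: the pointwise identity behind `apUpc_parallel_eq` —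
`q^{2|V|} q^{k(γ)+k(γᶜ)} (c - c̄) = q^{a₂} α(γ₂) · q^{a₁}(c₁ - c̄₁) + q^{a₁} β(γ₁) · q^{a₂}(c₂ - c̄₂)` with the nonnegative type weights
`α = (1-c₂)(1-c̄₂) + q(1-c₂)c̄₂`, `β = (1-c₁)(1-c̄₁) + q c₁(1-c̄₁)`. [cite: Grimmett2006, §3.8 (pp. 61–62)] -/
theorem ap_summand_parallel (q : ℝ) (hd : Disjoint E₁ E₂) (h₁ : ∀ e ∈ (↑E₁ : Set (Sym2 V)), ∀ z ∈ e, z ∈ V₁)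
    (h₂ : ∀ e ∈ (↑E₂ : Set (Sym2 V)), ∀ z ∈ e, z ∈ V₂) (hS : V₁ ∩ V₂ ⊆ {s, t}) (hst : s ≠ t)
    {M₁ M₂ γ₁ γ₂ : Finset (Sym2 V)} (hM₁ : M₁ ⊆ E₁) (hM₂ : M₂ ⊆ E₂) (hγ₁ : γ₁ ⊆ M₁) (hγ₂ : γ₂ ⊆ M₂) (x : ℝ) :
    q ^ (2 * Fintype.card V) *
        (q ^ apExp (M₁ ∪ M₂) (γ₁ ∪ γ₂) * ((apConn (γ₁ ∪ γ₂) s t - apConn ((M₁ ∪ M₂) \ (γ₁ ∪ γ₂)) s t) * x)) =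
      q ^ apExp M₂ γ₂ *
          (((1 - apConn γ₂ s t) * (1 - apConn (M₂ \ γ₂) s t) + q * ((1 - apConn γ₂ s t) * apConn (M₂ \ γ₂) s t)) *
            (q ^ apExp M₁ γ₁ * ((apConn γ₁ s t - apConn (M₁ \ γ₁) s t) * x))) +
        q ^ apExp M₁ γ₁ *
          (((1 - apConn γ₁ s t) * (1 - apConn (M₁ \ γ₁) s t) + q * (apConn γ₁ s t * (1 - apConn (M₁ \ γ₁) s t))) *
            (q ^ apExp M₂ γ₂ * ((apConn γ₂ s t - apConn (M₂ \ γ₂) s t) * x))) := by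
  have hdM : Disjoint M₁ M₂ := Finset.disjoint_of_subset_left hM₁ (Finset.disjoint_of_subset_right hM₂ hd)
  have hexp := apExp_parallel hd h₁ h₂ hS hst hM₁ hM₂ hγ₁ hγ₂
  -- the exponent identity as an identity of powers of `q`
  have hpow : q ^ (2 * Fintype.card V) * q ^ apExp (M₁ ∪ M₂) (γ₁ ∪ γ₂) =
      q ^ apExp M₁ γ₁ * q ^ apExp M₂ γ₂ *
        (q ^ (if (openGraph (↑γ₁ : BondConfig V)).Reachable s t ∧ (openGraph (↑γ₂ : BondConfig V)).Reachable s t then 1 else 0) *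
          q ^ (if (openGraph (↑(M₁ \ γ₁) : BondConfig V)).Reachable s t ∧ (openGraph (↑(M₂ \ γ₂) : BondConfig V)).Reachable s t
            then 1 else 0)) := by
    rw [← pow_add, ← pow_add, ← pow_add, ← pow_add, add_comm (2 * Fintype.card V), hexp]
  -- terminal connections of the glued configurations
  have hc := reachable_union_parallel h₁ h₂ hS (hγ₁.trans hM₁) (hγ₂.trans hM₂)
  have hcb : (openGraph (↑((M₁ ∪ M₂) \ (γ₁ ∪ γ₂)) : BondConfig V)).Reachable s t ↔
      (openGraph (↑(M₁ \ γ₁) : BondConfig V)).Reachable s t ∨ (openGraph (↑(M₂ \ γ₂) : BondConfig V)).Reachable s t := by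
    rw [union_sdiff_union hdM hγ₁ hγ₂]
    exact reachable_union_parallel h₁ h₂ hS (Finset.sdiff_subset.trans hM₁) (Finset.sdiff_subset.trans hM₂)
  calc q ^ (2 * Fintype.card V) *
        (q ^ apExp (M₁ ∪ M₂) (γ₁ ∪ γ₂) * ((apConn (γ₁ ∪ γ₂) s t - apConn ((M₁ ∪ M₂) \ (γ₁ ∪ γ₂)) s t) * x))
      = (q ^ (2 * Fintype.card V) * q ^ apExp (M₁ ∪ M₂) (γ₁ ∪ γ₂)) *
          ((apConn (γ₁ ∪ γ₂) s t - apConn ((M₁ ∪ M₂) \ (γ₁ ∪ γ₂)) s t) * x) := by ring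
    _ = _ := by
      rw [hpow]
      unfold apConn
      rw [hc, hcb]
      by_cases a₁ : (openGraph (↑γ₁ : BondConfig V)).Reachable s t <;>
      by_cases a₂ : (openGraph (↑γ₂ : BondConfig V)).Reachable s t <;>
      by_cases b₁ : (openGraph (↑(M₁ \ γ₁) : BondConfig V)).Reachable s t <;>
      by_cases b₂ : (openGraph (↑(M₂ \ γ₂) : BondConfig V)).Reachable s t <;>
      simp only [a₁, a₂, b₁, b₂, and_self, and_true, true_and, and_false, false_and, or_self, or_true, true_or, or_false,
        false_or, if_true, if_false, not_false_eq_true, not_true_eq_false, pow_one, pow_zero] <;> ring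

/-- **Parallel composition of the antipodal up-correlation functional**: for `M = M₁ ⊔ M₂` inside a parallel gluing,
`q^{2|V|} · apUpc(M; h) = ∑_{γ₂ ⊆ M₂} q^{a₂} α(γ₂) · apUpc(M₁; h(· ∪ γ₂)) + ∑_{γ₁ ⊆ M₁} q^{a₁} β(γ₁) · apUpc(M₂; h(γ₁ ∪ ·))` — each
part's functional applied to the SECTIONS of `h`, integrated against nonnegative type weights of the other part.
[cite: Grimmett2006, §3.8 Thm. (3.90) (pp. 61–62)] -/
theorem apUpc_parallel_eq (q : ℝ) (hd : Disjoint E₁ E₂) (h₁ : ∀ e ∈ (↑E₁ : Set (Sym2 V)), ∀ z ∈ e, z ∈ V₁)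
    (h₂ : ∀ e ∈ (↑E₂ : Set (Sym2 V)), ∀ z ∈ e, z ∈ V₂) (hS : V₁ ∩ V₂ ⊆ {s, t}) (hst : s ≠ t)
    {M₁ M₂ : Finset (Sym2 V)} (hM₁ : M₁ ⊆ E₁) (hM₂ : M₂ ⊆ E₂) (h : Finset (Sym2 V) → ℝ) :
    q ^ (2 * Fintype.card V) * apUpc q (M₁ ∪ M₂) s t h =
      ∑ γ₂ ∈ M₂.powerset, q ^ apExp M₂ γ₂ *
          (((1 - apConn γ₂ s t) * (1 - apConn (M₂ \ γ₂) s t) + q * ((1 - apConn γ₂ s t) * apConn (M₂ \ γ₂) s t)) *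
            apUpc q M₁ s t (fun γ₁ => h (γ₁ ∪ γ₂))) +
        ∑ γ₁ ∈ M₁.powerset, q ^ apExp M₁ γ₁ *
          (((1 - apConn γ₁ s t) * (1 - apConn (M₁ \ γ₁) s t) + q * (apConn γ₁ s t * (1 - apConn (M₁ \ γ₁) s t))) *
            apUpc q M₂ s t (fun γ₂ => h (γ₁ ∪ γ₂))) := by
  have hdM : Disjoint M₁ M₂ := Finset.disjoint_of_subset_left hM₁ (Finset.disjoint_of_subset_right hM₂ hd)
  unfold apUpc
  rw [Finset.mul_sum, sum_powerset_union_disj hdM]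
  simp_rw [Finset.mul_sum]
  rw [Finset.sum_comm (s := M₂.powerset) (t := M₁.powerset), ← Finset.sum_add_distrib]
  refine Finset.sum_congr rfl fun γ₁ hγ₁ => ?_
  rw [← Finset.sum_add_distrib]
  refine Finset.sum_congr rfl fun γ₂ hγ₂ => ?_
  rw [Finset.mem_powerset] at hγ₁ hγ₂
  exact ap_summand_parallel q hd h₁ h₂ hS hst hM₁ hM₂ hγ₁ hγ₂ (h (γ₁ ∪ γ₂))

/-- **The antipodal up-correlation property is closed under parallel composition**: if `0 ≤ apUpc(M₁; h')` and `0 ≤ apUpc(M₂; h')`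
for all test functions `h'` monotone on the subsets of `M₁`, resp. `M₂`, then `0 ≤ apUpc(M₁ ⊔ M₂; h)` for every `h` monotone on the
subsets of `M₁ ⊔ M₂` (`q > 0`). [cite: Grimmett2006, §3.8 Thm. (3.90) (pp. 61–62)] -/
theorem apUpc_parallel_nonneg {q : ℝ} (hq : 0 < q) (hd : Disjoint E₁ E₂) (h₁ : ∀ e ∈ (↑E₁ : Set (Sym2 V)), ∀ z ∈ e, z ∈ V₁)
    (h₂ : ∀ e ∈ (↑E₂ : Set (Sym2 V)), ∀ z ∈ e, z ∈ V₂) (hS : V₁ ∩ V₂ ⊆ {s, t}) (hst : s ≠ t)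
    {M₁ M₂ : Finset (Sym2 V)} (hM₁ : M₁ ⊆ E₁) (hM₂ : M₂ ⊆ E₂)
    (ih₁ : ∀ h' : Finset (Sym2 V) → ℝ, (∀ ⦃A B : Finset (Sym2 V)⦄, A ⊆ B → B ⊆ M₁ → h' A ≤ h' B) → 0 ≤ apUpc q M₁ s t h')
    (ih₂ : ∀ h' : Finset (Sym2 V) → ℝ, (∀ ⦃A B : Finset (Sym2 V)⦄, A ⊆ B → B ⊆ M₂ → h' A ≤ h' B) → 0 ≤ apUpc q M₂ s t h')
    {h : Finset (Sym2 V) → ℝ} (hmono : ∀ ⦃A B : Finset (Sym2 V)⦄, A ⊆ B → B ⊆ M₁ ∪ M₂ → h A ≤ h B) :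
    0 ≤ apUpc q (M₁ ∪ M₂) s t h := by
  have key := apUpc_parallel_eq q hd h₁ h₂ hS hst hM₁ hM₂ h
  have hpos : 0 < q ^ (2 * Fintype.card V) := pow_pos hq _
  refine (mul_nonneg_iff_of_pos_left hpos).1 ?_
  · rw [key]
    refine add_nonneg (Finset.sum_nonneg fun γ₂ hγ₂ => ?_) (Finset.sum_nonneg fun γ₁ hγ₁ => ?_)
    · rw [Finset.mem_powerset] at hγ₂
      have hc0 := apConn_nonneg γ₂ s t
      have hc1 := apConn_le_one γ₂ s t
      have hd0 := apConn_nonneg (M₂ \ γ₂) s t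
      have hd1 := apConn_le_one (M₂ \ γ₂) s t
      refine mul_nonneg (pow_nonneg hq.le _) (mul_nonneg ?_ (ih₁ _ fun A B hAB hB => ?_))
      · exact add_nonneg (mul_nonneg (sub_nonneg.2 hc1) (sub_nonneg.2 hd1))
          (mul_nonneg hq.le (mul_nonneg (sub_nonneg.2 hc1) hd0))
      · exact hmono (Finset.union_subset_union hAB le_rfl) (Finset.union_subset_union hB hγ₂)
    · rw [Finset.mem_powerset] at hγ₁
      have hc0 := apConn_nonneg γ₁ s t
      have hc1 := apConn_le_one γ₁ s t
      have hd0 := apConn_nonneg (M₁ \ γ₁) s t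
      have hd1 := apConn_le_one (M₁ \ γ₁) s t
      refine mul_nonneg (pow_nonneg hq.le _) (mul_nonneg ?_ (ih₂ _ fun A B hAB hB => ?_))
      · exact add_nonneg (mul_nonneg (sub_nonneg.2 hc1) (sub_nonneg.2 hd1))
          (mul_nonneg hq.le (mul_nonneg hc0 (sub_nonneg.2 hd1)))
      · exact hmono (Finset.union_subset_union le_rfl hAB) (Finset.union_subset_union hγ₁ hB)

end Parallel

/-! ### Series composition -/

section Series

variable {E₁ E₂ : Finset (Sym2 V)} {V₁ V₂ : Set V} {a m b : V}

/-- **Series gluing, antipodal exponent**: `k(γ) + k(γᶜ) + 2|V| = (k(γ₁) + k(γ₁ᶜ)) + (k(γ₂) + k(γ₂ᶜ))` for `γ = γ₁ ⊔ γ₂` inside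
`M = M₁ ⊔ M₂`, the parts meeting in one vertex. [cite: Grimmett2006, §3.8 (pp. 61–62)] -/
theorem apExp_series (hd : Disjoint E₁ E₂) (h₁ : ∀ e ∈ (↑E₁ : Set (Sym2 V)), ∀ z ∈ e, z ∈ V₁)
    (h₂ : ∀ e ∈ (↑E₂ : Set (Sym2 V)), ∀ z ∈ e, z ∈ V₂) (hS : V₁ ∩ V₂ ⊆ {m})
    {M₁ M₂ γ₁ γ₂ : Finset (Sym2 V)} (hM₁ : M₁ ⊆ E₁) (hM₂ : M₂ ⊆ E₂) (hγ₁ : γ₁ ⊆ M₁) (hγ₂ : γ₂ ⊆ M₂) :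
    apExp (M₁ ∪ M₂) (γ₁ ∪ γ₂) + 2 * Fintype.card V = apExp M₁ γ₁ + apExp M₂ γ₂ := by
  have hdM : Disjoint M₁ M₂ := Finset.disjoint_of_subset_left hM₁ (Finset.disjoint_of_subset_right hM₂ hd)
  have k1 := clusterCount_series (ω₁ := (↑γ₁ : Set (Sym2 V))) (ω₂ := (↑γ₂ : Set (Sym2 V))) h₁ h₂ hS
    (Finset.coe_subset.2 (hγ₁.trans hM₁)) (Finset.coe_subset.2 (hγ₂.trans hM₂))
  have k2 := clusterCount_series (ω₁ := (↑(M₁ \ γ₁) : Set (Sym2 V))) (ω₂ := (↑(M₂ \ γ₂) : Set (Sym2 V))) h₁ h₂ hS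
    (Finset.coe_subset.2 (Finset.sdiff_subset.trans hM₁)) (Finset.coe_subset.2 (Finset.sdiff_subset.trans hM₂))
  unfold apExp
  rw [union_sdiff_union hdM hγ₁ hγ₂, Finset.coe_union, Finset.coe_union]
  omega

omit [Fintype V] in
/-- **Series gluing, terminal connection**: `a ↔ b` in `γ₁ ⊔ γ₂` iff `a ↔ m` in `γ₁` and `m ↔ b` in `γ₂`. [folklore] -/
theorem reachable_union_series (h₁ : ∀ e ∈ (↑E₁ : Set (Sym2 V)), ∀ z ∈ e, z ∈ V₁)
    (h₂ : ∀ e ∈ (↑E₂ : Set (Sym2 V)), ∀ z ∈ e, z ∈ V₂) (hS : V₁ ∩ V₂ ⊆ {m}) (haV₂ : a ∉ V₂) (hbV₁ : b ∉ V₁)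
    (ham : a ≠ m) (hbm : b ≠ m) (hab : a ≠ b) {γ₁ γ₂ : Finset (Sym2 V)} (hγ₁ : γ₁ ⊆ E₁) (hγ₂ : γ₂ ⊆ E₂) :
    (openGraph (↑(γ₁ ∪ γ₂) : BondConfig V)).Reachable a b ↔
      (openGraph (↑γ₁ : BondConfig V)).Reachable a m ∧ (openGraph (↑γ₂ : BondConfig V)).Reachable m b := by
  rw [Finset.coe_union]
  exact reachable_series_iff h₁ h₂ hS (Finset.coe_subset.2 hγ₁) (Finset.coe_subset.2 hγ₂) haV₂ hbV₁ ham hbm hab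

set_option linter.unusedSimpArgs false in
/-- **Series gluing, the antipodal summand**: `q^{2|V|} q^{k(γ)+k(γᶜ)} (c - c̄) = q^{a₂} c̄₂ · q^{a₁}(c₁ - c̄₁) + q^{a₁} c₁ · q^{a₂}(c₂ - c̄₂)`
(`c = c₁ c₂`, `c̄ = c̄₁ c̄₂`). [cite: Grimmett2006, §3.8 (pp. 61–62)] -/
theorem ap_summand_series (q : ℝ) (hd : Disjoint E₁ E₂) (h₁ : ∀ e ∈ (↑E₁ : Set (Sym2 V)), ∀ z ∈ e, z ∈ V₁)
    (h₂ : ∀ e ∈ (↑E₂ : Set (Sym2 V)), ∀ z ∈ e, z ∈ V₂) (hS : V₁ ∩ V₂ ⊆ {m}) (haV₂ : a ∉ V₂) (hbV₁ : b ∉ V₁)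
    (ham : a ≠ m) (hbm : b ≠ m) (hab : a ≠ b)
    {M₁ M₂ γ₁ γ₂ : Finset (Sym2 V)} (hM₁ : M₁ ⊆ E₁) (hM₂ : M₂ ⊆ E₂) (hγ₁ : γ₁ ⊆ M₁) (hγ₂ : γ₂ ⊆ M₂) (x : ℝ) :
    q ^ (2 * Fintype.card V) *
        (q ^ apExp (M₁ ∪ M₂) (γ₁ ∪ γ₂) * ((apConn (γ₁ ∪ γ₂) a b - apConn ((M₁ ∪ M₂) \ (γ₁ ∪ γ₂)) a b) * x)) =
      q ^ apExp M₂ γ₂ * (apConn (M₂ \ γ₂) m b * (q ^ apExp M₁ γ₁ * ((apConn γ₁ a m - apConn (M₁ \ γ₁) a m) * x))) +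
        q ^ apExp M₁ γ₁ * (apConn γ₁ a m * (q ^ apExp M₂ γ₂ * ((apConn γ₂ m b - apConn (M₂ \ γ₂) m b) * x))) := by
  have hdM : Disjoint M₁ M₂ := Finset.disjoint_of_subset_left hM₁ (Finset.disjoint_of_subset_right hM₂ hd)
  have hexp := apExp_series hd h₁ h₂ hS hM₁ hM₂ hγ₁ hγ₂
  have hpow : q ^ (2 * Fintype.card V) * q ^ apExp (M₁ ∪ M₂) (γ₁ ∪ γ₂) = q ^ apExp M₁ γ₁ * q ^ apExp M₂ γ₂ := by
    rw [← pow_add, ← pow_add, add_comm (2 * Fintype.card V), hexp]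
  have hc := reachable_union_series h₁ h₂ hS haV₂ hbV₁ ham hbm hab (hγ₁.trans hM₁) (hγ₂.trans hM₂)
  have hcb : (openGraph (↑((M₁ ∪ M₂) \ (γ₁ ∪ γ₂)) : BondConfig V)).Reachable a b ↔
      (openGraph (↑(M₁ \ γ₁) : BondConfig V)).Reachable a m ∧ (openGraph (↑(M₂ \ γ₂) : BondConfig V)).Reachable m b := by
    rw [union_sdiff_union hdM hγ₁ hγ₂]
    exact reachable_union_series h₁ h₂ hS haV₂ hbV₁ ham hbm hab (Finset.sdiff_subset.trans hM₁)
      (Finset.sdiff_subset.trans hM₂)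
  calc q ^ (2 * Fintype.card V) *
        (q ^ apExp (M₁ ∪ M₂) (γ₁ ∪ γ₂) * ((apConn (γ₁ ∪ γ₂) a b - apConn ((M₁ ∪ M₂) \ (γ₁ ∪ γ₂)) a b) * x))
      = (q ^ (2 * Fintype.card V) * q ^ apExp (M₁ ∪ M₂) (γ₁ ∪ γ₂)) *
          ((apConn (γ₁ ∪ γ₂) a b - apConn ((M₁ ∪ M₂) \ (γ₁ ∪ γ₂)) a b) * x) := by ring
    _ = _ := by
      rw [hpow]
      unfold apConn
      rw [hc, hcb]
      by_cases a₁ : (openGraph (↑γ₁ : BondConfig V)).Reachable a m <;>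
      by_cases a₂ : (openGraph (↑γ₂ : BondConfig V)).Reachable m b <;>
      by_cases b₁ : (openGraph (↑(M₁ \ γ₁) : BondConfig V)).Reachable a m <;>
      by_cases b₂ : (openGraph (↑(M₂ \ γ₂) : BondConfig V)).Reachable m b <;>
      simp only [a₁, a₂, b₁, b₂, and_self, and_true, true_and, and_false, false_and, if_true, if_false,
        not_false_eq_true, not_true_eq_false] <;> ring

/-- **Series composition of the antipodal up-correlation functional**: for `M = M₁ ⊔ M₂` inside a series gluing at `m`,
`q^{2|V|} · apUpc(M; a, b; h) = ∑_{γ₂ ⊆ M₂} q^{a₂} c̄₂ · apUpc(M₁; a, m; h(· ∪ γ₂)) + ∑_{γ₁ ⊆ M₁} q^{a₁} c₁ · apUpc(M₂; m, b; h(γ₁ ∪ ·))`.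
[cite: Grimmett2006, §3.8 Thm. (3.90) (pp. 61–62)] -/
theorem apUpc_series_eq (q : ℝ) (hd : Disjoint E₁ E₂) (h₁ : ∀ e ∈ (↑E₁ : Set (Sym2 V)), ∀ z ∈ e, z ∈ V₁)
    (h₂ : ∀ e ∈ (↑E₂ : Set (Sym2 V)), ∀ z ∈ e, z ∈ V₂) (hS : V₁ ∩ V₂ ⊆ {m}) (haV₂ : a ∉ V₂) (hbV₁ : b ∉ V₁)
    (ham : a ≠ m) (hbm : b ≠ m) (hab : a ≠ b) {M₁ M₂ : Finset (Sym2 V)} (hM₁ : M₁ ⊆ E₁) (hM₂ : M₂ ⊆ E₂)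
    (h : Finset (Sym2 V) → ℝ) :
    q ^ (2 * Fintype.card V) * apUpc q (M₁ ∪ M₂) a b h =
      ∑ γ₂ ∈ M₂.powerset, q ^ apExp M₂ γ₂ * (apConn (M₂ \ γ₂) m b * apUpc q M₁ a m (fun γ₁ => h (γ₁ ∪ γ₂))) +
        ∑ γ₁ ∈ M₁.powerset, q ^ apExp M₁ γ₁ * (apConn γ₁ a m * apUpc q M₂ m b (fun γ₂ => h (γ₁ ∪ γ₂))) := by
  have hdM : Disjoint M₁ M₂ := Finset.disjoint_of_subset_left hM₁ (Finset.disjoint_of_subset_right hM₂ hd)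
  unfold apUpc
  rw [Finset.mul_sum, sum_powerset_union_disj hdM]
  simp_rw [Finset.mul_sum]
  rw [Finset.sum_comm (s := M₂.powerset) (t := M₁.powerset), ← Finset.sum_add_distrib]
  refine Finset.sum_congr rfl fun γ₁ hγ₁ => ?_
  rw [← Finset.sum_add_distrib]
  refine Finset.sum_congr rfl fun γ₂ hγ₂ => ?_
  rw [Finset.mem_powerset] at hγ₁ hγ₂
  exact ap_summand_series q hd h₁ h₂ hS haV₂ hbV₁ ham hbm hab hM₁ hM₂ hγ₁ hγ₂ (h (γ₁ ∪ γ₂))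

/-- **The antipodal up-correlation property is closed under series composition** (`q > 0`).
[cite: Grimmett2006, §3.8 Thm. (3.90) (pp. 61–62)] -/
theorem apUpc_series_nonneg {q : ℝ} (hq : 0 < q) (hd : Disjoint E₁ E₂) (h₁ : ∀ e ∈ (↑E₁ : Set (Sym2 V)), ∀ z ∈ e, z ∈ V₁)
    (h₂ : ∀ e ∈ (↑E₂ : Set (Sym2 V)), ∀ z ∈ e, z ∈ V₂) (hS : V₁ ∩ V₂ ⊆ {m}) (haV₂ : a ∉ V₂) (hbV₁ : b ∉ V₁)
    (ham : a ≠ m) (hbm : b ≠ m) (hab : a ≠ b) {M₁ M₂ : Finset (Sym2 V)} (hM₁ : M₁ ⊆ E₁) (hM₂ : M₂ ⊆ E₂)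
    (ih₁ : ∀ h' : Finset (Sym2 V) → ℝ, (∀ ⦃A B : Finset (Sym2 V)⦄, A ⊆ B → B ⊆ M₁ → h' A ≤ h' B) → 0 ≤ apUpc q M₁ a m h')
    (ih₂ : ∀ h' : Finset (Sym2 V) → ℝ, (∀ ⦃A B : Finset (Sym2 V)⦄, A ⊆ B → B ⊆ M₂ → h' A ≤ h' B) → 0 ≤ apUpc q M₂ m b h')
    {h : Finset (Sym2 V) → ℝ} (hmono : ∀ ⦃A B : Finset (Sym2 V)⦄, A ⊆ B → B ⊆ M₁ ∪ M₂ → h A ≤ h B) :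
    0 ≤ apUpc q (M₁ ∪ M₂) a b h := by
  have key := apUpc_series_eq q hd h₁ h₂ hS haV₂ hbV₁ ham hbm hab hM₁ hM₂ h
  have hpos : 0 < q ^ (2 * Fintype.card V) := pow_pos hq _
  refine (mul_nonneg_iff_of_pos_left hpos).1 ?_
  rw [key]
  refine add_nonneg (Finset.sum_nonneg fun γ₂ hγ₂ => ?_) (Finset.sum_nonneg fun γ₁ hγ₁ => ?_)
  · rw [Finset.mem_powerset] at hγ₂
    refine mul_nonneg (pow_nonneg hq.le _) (mul_nonneg (apConn_nonneg _ _ _) (ih₁ _ fun A B hAB hB => ?_))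
    exact hmono (Finset.union_subset_union hAB le_rfl) (Finset.union_subset_union hB hγ₂)
  · rw [Finset.mem_powerset] at hγ₁
    refine mul_nonneg (pow_nonneg hq.le _) (mul_nonneg (apConn_nonneg _ _ _) (ih₂ _ fun A B hAB hB => ?_))
    exact hmono (Finset.union_subset_union le_rfl hAB) (Finset.union_subset_union hγ₁ hB)

end Series

end FK

end Summit.CriticalPhenomena.PercolationContinuityZ3.Theorems

end
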